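import Summits.QuantumAdvantage.QuantumAdvantage.Theorems.LinnikCubicClassGroupsDegreeOnePrimesEscapeBrauerSiegelLower
import Summits.QuantumAdvantage.QuantumAdvantage.Theorems.LinnikCubicClassGroupsDegreeOnePrimesEscapeResidueUpper
import Literature.NumberTheory.NumberFields.RegulatorLowerBound
import Literature.NumberTheory.NumberFields.UnitHeightGap
import HarnessLib

/-!
# The effective Brauer–Siegel theorem for cubic (and odd-degree) number fields, with an explicit error

Topic `Summits/QuantumAdvantage/QuantumAdvantage/Theorems`, helper file of the (closed) crux
`DegreeOnePrimesEscape` (stmt-QuantumAdvantage-11543) of route `LinnikCubicClassGroups`; cell B2b-1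
(linnik-cubic), PART B.  HONEST FRAMING: the value of this file is a THEOREM (kernel-checked, explicit
combination of the cell's effective lower bound — Stark 1974 — and upper bound — Landau 1918 / Louboutin
2000) — NOT summit progress.  Everything here is PROVED (standard axioms).

* `abs_log_classNumber_mul_regulator_sub_le_cubic` — for EVERY cubic number field `K`,
  `|log(h_K R_K) − ½ log|d_K|| ≤ 2 · log log|d_K| + 26`
  (from `√|d_K| ≤ 10¹¹ h_K R_K log|d_K|` and `h_K R_K ≤ 7 √|d_K| log²|d_K|`; `log 10¹¹ ≤ 26`, `log 7 ≤ 2` inlined).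
  In particular `log(h_K R_K) ∼ ½ log|d_K|` along ANY sequence of cubic fields, effectively — the
  Brauer–Siegel theorem for the family of all cubic fields with an explicit, kernel-checked error term.
* `exists_abs_log_classNumber_mul_regulator_sub_le_of_odd` — for every odd `n > 1` there is an explicit
  `C(n)` with `|log(h_K R_K) − ½ log|d_K|| ≤ (n − 1) · log log|d_K| + C(n)` for every `K` of degree `n`.
* `exists_abs_log_classNumber_mul_regulator_sub_le` — the same for every degree `n > 1` and every `K` of
  degree `n` WITHOUT quadratic subfield (Stark's hypothesis; the upper bound needs none);
* `regulator_le_cubic` — `R_K ≤ 7√|d_K| log²|d_K|` for every cubic field (`h_K ≥ 1`);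
* `classNumber_le_cubic` — `∃ C, ∀` cubic `K`, `h_K ≤ C · √|d_K| · log²|d_K|` (with the tree's regulator
  lower bound `exists_regulator_ge_of_finrank_le`); `exists_classNumber_le_sqrt_mul_log_pow` — for every
  `n ≥ 2`, `∃ C(n), ∀ K` of degree `n`, `h_K ≤ C · √|d_K| · (log|d_K|)^{n−1}` (also `w_K ≤ W(n)`,
  `exists_torsionOrder_le_of_finrank_le`).

PLACEMENT: Stark 1974 (effective Brauer–Siegel when there is no quadratic subfield) + Landau 1918 /
Louboutin 2000 (upper bound); the combination for cubic fields is classical knowledge; the explicit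
constants `26`, `2` and the kernel check are the only additions.

## References
* H. M. Stark, Invent. Math. 23 (1974) 135–152, Thm 1. [Stark1974]
* S. Louboutin, J. Number Theory 85 (2000) 263–282, Thm 1. [Louboutin2000]
* R. Brauer, Amer. J. Math. 69 (1947) 243–250 (the ineffective theorem in general).
-/

noncomputable section

open NumberField NumberField.InfinitePlace NumberField.Units

namespace Summit.QuantumAdvantage.QuantumAdvantage.Theorems.DegreeOnePrimesEscape

namespace Residue

open Literature.NumberTheory.NumberFields

/-- **Effective Brauer–Siegel for every cubic field, explicit**:
`|log(h_K R_K) − ½ log|d_K|| ≤ 2 log log|d_K| + 26`. [cite: Stark1974, Thm 1; Louboutin2000, Thm 1] -/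
theorem abs_log_classNumber_mul_regulator_sub_le_cubic (K : Type) [Field K] [NumberField K]
    (hK : Module.finrank ℚ K = 3) :
    |Real.log ((classNumber K : ℝ) * regulator K) - Real.log |(discr K : ℝ)| / 2| ≤
      2 * Real.log (Real.log |(discr K : ℝ)|) + 26 := by
  set X : ℝ := (classNumber K : ℝ) * regulator K with hX
  set d : ℝ := |(discr K : ℝ)| with hd
  have log_ten_pow_eleven_le : Real.log ((10 : ℝ) ^ 11) ≤ 26 := by
    rw [Real.log_le_iff_le_exp (by positivity)]
    have h1 : (2.7182818283 : ℝ) < Real.exp 1 := Real.exp_one_gt_d9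
    have h26 : Real.exp 26 = Real.exp 1 ^ 26 := by rw [← Real.exp_nat_mul]; norm_num
    rw [h26]
    have : (2.7182818283 : ℝ) ^ 26 ≤ Real.exp 1 ^ 26 := pow_le_pow_left₀ (by norm_num) h1.le 26
    linarith [show (10 : ℝ) ^ 11 ≤ (2.7182818283 : ℝ) ^ 26 by norm_num]
  have log_seven_le_two : Real.log (7 : ℝ) ≤ 2 := by
    rw [Real.log_le_iff_le_exp (by positivity)]
    have h1 : (2.7182818283 : ℝ) < Real.exp 1 := Real.exp_one_gt_d9
    have h2 : Real.exp 2 = Real.exp 1 ^ 2 := by rw [← Real.exp_nat_mul]; norm_num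
    rw [h2]
    nlinarith [Real.exp_pos (1 : ℝ)]
  have hlow := sqrt_abs_discr_le_of_finrank_eq_three K hK
  have hup := classNumber_mul_regulator_le_cubic K hK
  rw [← hX, ← hd] at hlow hup
  -- sizes
  have hX0 : 0 < X := mul_pos (by exact_mod_cast classNumber_pos K) (regulator_pos K)
  have hd3 : (3 : ℝ) ≤ d := by
    have h2 := NumberField.abs_discr_gt_two (K := K) (by rw [hK]; norm_num)
    rw [hd, ← Int.cast_abs]
    exact_mod_cast (show (3 : ℤ) ≤ |discr K| by omega)
  have hd0 : 0 < d := by linarith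
  set L : ℝ := Real.log d with hL
  have hL1 : 1 < L := by
    rw [hL, Real.lt_log_iff_exp_lt hd0]
    have := Real.exp_one_lt_d9; linarith
  have hL0 : 0 < L := by linarith
  have hlogL0 : 0 ≤ Real.log L := Real.log_nonneg hL1.le
  have hsd0 : 0 < Real.sqrt d := Real.sqrt_pos.mpr hd0
  have hsqrt : Real.log (Real.sqrt d) = L / 2 := by rw [Real.log_sqrt hd0.le]
  -- upper: `log X ≤ log 7 + L/2 + 2 log L`
  have hup' : Real.log X ≤ 2 + L / 2 + 2 * Real.log L := by
    have h1 : Real.log X ≤ Real.log (7 * Real.sqrt d * L ^ 2) := Real.log_le_log hX0 hup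
    have h2 : Real.log (7 * Real.sqrt d * L ^ 2) = Real.log 7 + L / 2 + 2 * Real.log L := by
      rw [Real.log_mul (by positivity) (pow_ne_zero _ hL0.ne'), Real.log_mul (by norm_num) hsd0.ne', hsqrt,
        Real.log_pow]
      push_cast; ring
    linarith [log_seven_le_two]
  -- lower: `L/2 ≤ 26 + log X + log L`
  have hlow' : L / 2 ≤ 26 + Real.log X + Real.log L := by
    have h1 : Real.log (Real.sqrt d) ≤ Real.log (10 ^ 11 * X * L) := Real.log_le_log hsd0 hlow
    have h2 : Real.log (10 ^ 11 * X * L) = Real.log ((10 : ℝ) ^ 11) + Real.log X + Real.log L := by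
      rw [Real.log_mul (by positivity) hL0.ne', Real.log_mul (by positivity) hX0.ne']
    have h3 := log_ten_pow_eleven_le
    linarith
  rw [abs_le]
  constructor <;> linarith

/-- **Effective Brauer–Siegel for every odd degree `n > 1`**: there is an explicit `C = C(n)` with
`|log(h_K R_K) − ½ log|d_K|| ≤ (n − 1) log log|d_K| + C` for every number field `K` of degree `n`.
[cite: Stark1974, Thm 1; Louboutin2000, Thm 1] -/
theorem exists_abs_log_classNumber_mul_regulator_sub_le_of_odd (n : ℕ) (hn : 1 < n) (hodd : Odd n) :
    ∃ C : ℝ, ∀ (K : Type) [Field K] [NumberField K], Module.finrank ℚ K = n →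
      |Real.log ((classNumber K : ℝ) * regulator K) - Real.log |(discr K : ℝ)| / 2| ≤
        (n - 1 : ℝ) * Real.log (Real.log |(discr K : ℝ)|) + C := by
  obtain ⟨c, hc, hlow⟩ := exists_classNumber_mul_regulator_ge_of_odd n hn hodd
  refine ⟨max (Real.log (1 / c)) (Real.log (4 * Real.exp (1 / 2))), fun K _ _ hKn => ?_⟩
  set X : ℝ := (classNumber K : ℝ) * regulator K with hX
  set d : ℝ := |(discr K : ℝ)| with hd
  have hK1 : 1 < Module.finrank ℚ K := by rw [hKn]; exact hn
  have hKodd : Odd (Module.finrank ℚ K) := by rw [hKn]; exact hodd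
  have h1 := hlow K hKn
  have h2 := classNumber_mul_regulator_le_of_odd' K hK1 hKodd
  rw [← hX, ← hd, hKn] at h2
  rw [← hX, ← hd] at h1
  -- sizes
  have hX0 : 0 < X := mul_pos (by exact_mod_cast classNumber_pos K) (regulator_pos K)
  have hd3 : (3 : ℝ) ≤ d := by
    have h2' := NumberField.abs_discr_gt_two (K := K) hK1
    rw [hd, ← Int.cast_abs]
    exact_mod_cast (show (3 : ℤ) ≤ |discr K| by omega)
  have hd0 : 0 < d := by linarith
  set L : ℝ := Real.log d with hL
  have hL1 : 1 < L := by
    rw [hL, Real.lt_log_iff_exp_lt hd0]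
    have := Real.exp_one_lt_d9; linarith
  have hL0 : 0 < L := by linarith
  have hlogL0 : 0 ≤ Real.log L := Real.log_nonneg hL1.le
  have hsd0 : 0 < Real.sqrt d := Real.sqrt_pos.mpr hd0
  have hsqrt : Real.log (Real.sqrt d) = L / 2 := by rw [Real.log_sqrt hd0.le]
  have hn1 : (1 : ℝ) ≤ (n : ℝ) - 1 := by
    have : (2 : ℝ) ≤ n := by exact_mod_cast hn
    linarith
  have hcast : ((n - 1 : ℕ) : ℝ) = (n : ℝ) - 1 := by
    rw [Nat.cast_sub hn.le]; simp
  -- upper: `log X ≤ log(4√e) + L/2 + (n-1) log L`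
  have hup' : Real.log X ≤ Real.log (4 * Real.exp (1 / 2)) + L / 2 + ((n : ℝ) - 1) * Real.log L := by
    have h3 : Real.log X ≤ Real.log (4 * Real.exp (1 / 2) * Real.sqrt d * L ^ (n - 1)) :=
      Real.log_le_log hX0 h2
    have h4 : Real.log (4 * Real.exp (1 / 2) * Real.sqrt d * L ^ (n - 1)) =
        Real.log (4 * Real.exp (1 / 2)) + L / 2 + ((n : ℝ) - 1) * Real.log L := by
      rw [Real.log_mul (by positivity) (pow_ne_zero _ hL0.ne'), Real.log_mul (by positivity) hsd0.ne', hsqrt,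
        Real.log_pow, hcast]
    linarith
  -- lower: `log c + L/2 − log L ≤ log X`
  have hlow' : Real.log c + L / 2 - Real.log L ≤ Real.log X := by
    have h3 : Real.log (c * (Real.sqrt d / L)) ≤ Real.log X :=
      Real.log_le_log (by positivity) h1
    have h4 : Real.log (c * (Real.sqrt d / L)) = Real.log c + (L / 2 - Real.log L) := by
      rw [Real.log_mul hc.ne' (div_ne_zero hsd0.ne' hL0.ne'), Real.log_div hsd0.ne' hL0.ne', hsqrt]
    linarith
  have hlogc : Real.log (1 / c) = -Real.log c := by rw [one_div, Real.log_inv]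
  have hM1 : Real.log (1 / c) ≤ max (Real.log (1 / c)) (Real.log (4 * Real.exp (1 / 2))) := le_max_left _ _
  have hM2 : Real.log (4 * Real.exp (1 / 2)) ≤ max (Real.log (1 / c)) (Real.log (4 * Real.exp (1 / 2))) :=
    le_max_right _ _
  rw [abs_le]
  constructor
  · -- `-( (n-1) log L + C ) ≤ log X − L/2`
    have : Real.log L ≤ ((n : ℝ) - 1) * Real.log L := le_mul_of_one_le_left hlogL0 hn1
    linarith
  · linarith

/-- **`h_K ≤ C · √|d_K| · log²|d_K|` for every cubic field** (`C` effective: `7 / c_R(3)` with the tree's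
regulator lower bound `exists_regulator_ge_of_finrank_le 3`). [cite: Louboutin2000, Thm 1 (with a regulator lower bound)] -/
theorem classNumber_le_cubic :
    ∃ C : ℝ, 0 < C ∧ ∀ (K : Type) [Field K] [NumberField K], Module.finrank ℚ K = 3 →
      (classNumber K : ℝ) ≤ C * Real.sqrt |(discr K : ℝ)| * Real.log |(discr K : ℝ)| ^ 2 := by
  obtain ⟨c, hc, hreg⟩ := exists_regulator_ge_of_finrank_le 3
  refine ⟨7 / c, by positivity, fun K _ _ hK => ?_⟩
  have h1 := classNumber_mul_regulator_le_cubic K hK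
  have h2 := hreg K hK.le
  have hh0 : (0 : ℝ) ≤ classNumber K := by positivity
  have hq : 0 ≤ Real.sqrt |(discr K : ℝ)| * Real.log |(discr K : ℝ)| ^ 2 := by positivity
  rw [div_mul_eq_mul_div, div_mul_eq_mul_div, le_div_iff₀ hc]
  calc (classNumber K : ℝ) * c ≤ (classNumber K : ℝ) * regulator K := mul_le_mul_of_nonneg_left h2 hh0
    _ ≤ 7 * Real.sqrt |(discr K : ℝ)| * Real.log |(discr K : ℝ)| ^ 2 := h1

/-- **`h_K ≤ C(n) · √|d_K| · (log|d_K|)^{n−1}` for every number field of degree `n ≥ 2`** (`C(n)` effective: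
Landau's bound `h_K R_K ≤ 2e^{1/2} w_K √|d_K| log^{n−1}|d_K|` with `w_K ≤ W(n)` and `R_K ≥ c_R(n)` from the tree).
Mathlib proves the class group finite; this is the classical effective order of magnitude, kernel-checked.
[cite: Louboutin2000, Thm 1 (with a regulator lower bound)] -/
theorem exists_classNumber_le_sqrt_mul_log_pow (n : ℕ) (hn : 1 < n) :
    ∃ C : ℝ, 0 < C ∧ ∀ (K : Type) [Field K] [NumberField K], Module.finrank ℚ K = n →
      (classNumber K : ℝ) ≤ C * Real.sqrt |(discr K : ℝ)| * Real.log |(discr K : ℝ)| ^ (n - 1) := by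
  obtain ⟨c, hc, hreg⟩ := exists_regulator_ge_of_finrank_le n
  obtain ⟨W, hW⟩ := exists_torsionOrder_le_of_finrank_le n
  refine ⟨2 * Real.exp (1 / 2) * max (W : ℝ) 1 / c, by positivity, fun K _ _ hK => ?_⟩
  have hK1 : 1 < Module.finrank ℚ K := by rw [hK]; exact hn
  have h1 := classNumber_mul_regulator_le_sqrt_mul_log_pow K hK1
  rw [hK] at h1
  have h2 := hreg K hK.le
  have hw : (torsionOrder K : ℝ) ≤ max (W : ℝ) 1 := le_trans (by exact_mod_cast hW K hK.le) (le_max_left _ _)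
  have hh0 : (0 : ℝ) ≤ classNumber K := by positivity
  -- sizes: `log|d_K| > 0`
  have hd3 : (3 : ℝ) ≤ |(discr K : ℝ)| := by
    have h2' := NumberField.abs_discr_gt_two (K := K) hK1
    rw [← Int.cast_abs]
    exact_mod_cast (show (3 : ℤ) ≤ |discr K| by omega)
  have hlog0 : 0 < Real.log |(discr K : ℝ)| := Real.log_pos (by linarith)
  have hq : 0 ≤ Real.sqrt |(discr K : ℝ)| * Real.log |(discr K : ℝ)| ^ (n - 1) := by positivity
  rw [div_mul_eq_mul_div, div_mul_eq_mul_div, le_div_iff₀ hc]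
  calc (classNumber K : ℝ) * c ≤ (classNumber K : ℝ) * regulator K := mul_le_mul_of_nonneg_left h2 hh0
    _ ≤ 2 * Real.exp (1 / 2) * torsionOrder K * Real.sqrt |(discr K : ℝ)| * Real.log |(discr K : ℝ)| ^ (n - 1) := h1
    _ = 2 * Real.exp (1 / 2) * torsionOrder K * (Real.sqrt |(discr K : ℝ)| * Real.log |(discr K : ℝ)| ^ (n - 1)) := by
        ring
    _ ≤ 2 * Real.exp (1 / 2) * max (W : ℝ) 1 * (Real.sqrt |(discr K : ℝ)| * Real.log |(discr K : ℝ)| ^ (n - 1)) := by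
        apply mul_le_mul_of_nonneg_right _ hq
        exact mul_le_mul_of_nonneg_left hw (by positivity)
    _ = 2 * Real.exp (1 / 2) * max (W : ℝ) 1 * Real.sqrt |(discr K : ℝ)| * Real.log |(discr K : ℝ)| ^ (n - 1) := by
        ring

/-- **Effective Brauer–Siegel for every degree `n > 1` WITHOUT quadratic subfield**: an explicit `C = C(n)` with
`|log(h_K R_K) − ½ log|d_K|| ≤ (n − 1) log log|d_K| + C` for every `K` of degree `n` with no quadratic subfield
(lower bound: Stark; upper bound: Landau, valid for every field). [cite: Stark1974, Thm 1; Louboutin2000, Thm 1] -/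
theorem exists_abs_log_classNumber_mul_regulator_sub_le (n : ℕ) (hn : 1 < n) :
    ∃ C : ℝ, ∀ (K : Type) [Field K] [NumberField K], Module.finrank ℚ K = n →
      (∀ F : IntermediateField ℚ K, Module.finrank ℚ F ≠ 2) →
      |Real.log ((classNumber K : ℝ) * regulator K) - Real.log |(discr K : ℝ)| / 2| ≤
        (n - 1 : ℝ) * Real.log (Real.log |(discr K : ℝ)|) + C := by
  obtain ⟨c, hc, hlow⟩ := exists_classNumber_mul_regulator_ge n hn
  obtain ⟨W, hW⟩ := exists_torsionOrder_le_of_finrank_le n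
  refine ⟨max (Real.log (1 / c)) (Real.log (2 * Real.exp (1 / 2) * max (W : ℝ) 1)), fun K _ _ hKn hnq => ?_⟩
  set X : ℝ := (classNumber K : ℝ) * regulator K with hX
  set d : ℝ := |(discr K : ℝ)| with hd
  have hK1 : 1 < Module.finrank ℚ K := by rw [hKn]; exact hn
  have h1 := hlow K hKn hnq
  have h2 := classNumber_mul_regulator_le_sqrt_mul_log_pow K hK1
  rw [← hX, ← hd, hKn] at h2
  rw [← hX, ← hd] at h1
  -- sizes
  have hX0 : 0 < X := mul_pos (by exact_mod_cast classNumber_pos K) (regulator_pos K)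
  have hd3 : (3 : ℝ) ≤ d := by
    have h2' := NumberField.abs_discr_gt_two (K := K) hK1
    rw [hd, ← Int.cast_abs]
    exact_mod_cast (show (3 : ℤ) ≤ |discr K| by omega)
  have hd0 : 0 < d := by linarith
  set L : ℝ := Real.log d with hL
  have hL1 : 1 < L := by
    rw [hL, Real.lt_log_iff_exp_lt hd0]
    have := Real.exp_one_lt_d9; linarith
  have hL0 : 0 < L := by linarith
  have hlogL0 : 0 ≤ Real.log L := Real.log_nonneg hL1.le
  have hsd0 : 0 < Real.sqrt d := Real.sqrt_pos.mpr hd0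
  have hsqrt : Real.log (Real.sqrt d) = L / 2 := by rw [Real.log_sqrt hd0.le]
  have hn1 : (1 : ℝ) ≤ (n : ℝ) - 1 := by
    have : (2 : ℝ) ≤ n := by exact_mod_cast hn
    linarith
  have hcast : ((n - 1 : ℕ) : ℝ) = (n : ℝ) - 1 := by
    rw [Nat.cast_sub hn.le]; simp
  -- the torsion factor
  have hw0 : (0 : ℝ) < torsionOrder K := by exact_mod_cast torsionOrder_pos K
  have hwW : (torsionOrder K : ℝ) ≤ max (W : ℝ) 1 := le_trans (by exact_mod_cast hW K hKn.le) (le_max_left _ _)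
  set B : ℝ := 2 * Real.exp (1 / 2) * max (W : ℝ) 1 with hB
  have hB0 : 0 < B := by positivity
  have h2' : X ≤ B * Real.sqrt d * L ^ (n - 1) := by
    refine h2.trans ?_
    have hq : 0 ≤ Real.sqrt d * L ^ (n - 1) := by positivity
    calc 2 * Real.exp (1 / 2) * torsionOrder K * Real.sqrt d * L ^ (n - 1)
        = 2 * Real.exp (1 / 2) * torsionOrder K * (Real.sqrt d * L ^ (n - 1)) := by ring
      _ ≤ 2 * Real.exp (1 / 2) * max (W : ℝ) 1 * (Real.sqrt d * L ^ (n - 1)) := by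
          apply mul_le_mul_of_nonneg_right _ hq
          exact mul_le_mul_of_nonneg_left hwW (by positivity)
      _ = B * Real.sqrt d * L ^ (n - 1) := by rw [hB]; ring
  -- upper: `log X ≤ log B + L/2 + (n-1) log L`
  have hup' : Real.log X ≤ Real.log B + L / 2 + ((n : ℝ) - 1) * Real.log L := by
    have h3 : Real.log X ≤ Real.log (B * Real.sqrt d * L ^ (n - 1)) := Real.log_le_log hX0 h2'
    have h4 : Real.log (B * Real.sqrt d * L ^ (n - 1)) = Real.log B + L / 2 + ((n : ℝ) - 1) * Real.log L := by
      rw [Real.log_mul (by positivity) (pow_ne_zero _ hL0.ne'), Real.log_mul hB0.ne' hsd0.ne', hsqrt,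
        Real.log_pow, hcast]
    linarith
  -- lower: `log c + L/2 − log L ≤ log X`
  have hlow' : Real.log c + L / 2 - Real.log L ≤ Real.log X := by
    have h3 : Real.log (c * (Real.sqrt d / L)) ≤ Real.log X := Real.log_le_log (by positivity) h1
    have h4 : Real.log (c * (Real.sqrt d / L)) = Real.log c + (L / 2 - Real.log L) := by
      rw [Real.log_mul hc.ne' (div_ne_zero hsd0.ne' hL0.ne'), Real.log_div hsd0.ne' hL0.ne', hsqrt]
    linarith
  have hlogc : Real.log (1 / c) = -Real.log c := by rw [one_div, Real.log_inv]
  have hM1 : Real.log (1 / c) ≤ max (Real.log (1 / c)) (Real.log B) := le_max_left _ _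
  have hM2 : Real.log B ≤ max (Real.log (1 / c)) (Real.log B) := le_max_right _ _
  rw [abs_le]
  constructor
  · have : Real.log L ≤ ((n : ℝ) - 1) * Real.log L := le_mul_of_one_le_left hlogL0 hn1
    linarith
  · linarith

/-- **`R_K ≤ 7 · √|d_K| · log²|d_K|` for every cubic field** (`h_K ≥ 1`). [cite: Louboutin2000, Thm 1 (cruder constant)] -/
theorem regulator_le_cubic (K : Type) [Field K] [NumberField K] (hK : Module.finrank ℚ K = 3) :
    regulator K ≤ 7 * Real.sqrt |(discr K : ℝ)| * Real.log |(discr K : ℝ)| ^ 2 := by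
  have h := classNumber_mul_regulator_le_cubic K hK
  have hh1 : (1 : ℝ) ≤ classNumber K := by exact_mod_cast classNumber_pos K
  have hR0 : 0 < regulator K := regulator_pos K
  calc regulator K = 1 * regulator K := (one_mul _).symm
    _ ≤ (classNumber K : ℝ) * regulator K := mul_le_mul_of_nonneg_right hh1 hR0.le
    _ ≤ 7 * Real.sqrt |(discr K : ℝ)| * Real.log |(discr K : ℝ)| ^ 2 := h

end Residue

end Summit.QuantumAdvantage.QuantumAdvantage.Theorems.DegreeOnePrimesEscape

end
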